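import Literature.Probability.Percolation.ArmEventsStructure
import Literature.Probability.Percolation.ColourSwitching
import Literature.Probability.Percolation.OneArmLSW
import HarnessLib

/-!
# Plain arms from a landing tuple, and Nolin's finite-energy step at the inner radius

Topic `Literature/Probability/Percolation`; family `crit-perc` (site percolation on `𝕋`). One
EVENT and PROOFS (no named fact), toward the named fact `Nolin2008_thm24_fiveArm_upper`
(`FiveArmExponentFacts.lean`): the reduction of the order-free arm event `armEvent κ m n`
(`ArmEvents.lean`) to arms issued from a prescribed LANDING TUPLE on `∂Λ_m` that avoid `Λ_m`
otherwise, and the finite-energy identity that lets one PAINT the core `Λ_m` at constant cost —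
P. Nolin, *Near-critical percolation in two dimensions*, EJP 13 (2008), §4.1 (arXiv 0711.4948,
§4.1, on the extremities of arms on the inner boundary: "for the internal extremities … a finite
number of sites is concerned, so that we can prescribe their states at the cost of a constant
factor `2^{-|∂S_{n₀}|}`" — the finite-energy argument), in the form consumed by the
separation-free counting proof of the five-arm upper bound (`FiveArmKissingCount.lean`).

* `plainArms κ s m n` — the event of `k` pairwise vertex-disjoint self-avoiding arms, the `j`-th
  of colour `κ j` from the site `s j` to `∂Λ_n`, all of whose other sites have norm in `(m, n]`;
* `exists_plainArms_of_mem_armEvent` — **trimming**: for `m ≤ n`, a configuration of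
  `armEvent κ m n` lies in `plainArms κ s m n` for some injective landing tuple `s` on `∂Λ_m` (cut
  each arm at its last site of norm `≤ m`); `armEvent_subset_biUnion_plainArms`,
  `polyArmProb_le_sum_plainArms` — the union bound over the `≤ (12m+6)^k` tuples;
* `determinedBy_plainArms` — the event is determined by the sites `{s j} ∪ (Λ_n ∖ Λ_m)`;
* `paint D P` — the cylinder "the sites of `D` are open exactly on `P`"; `real_inter_paint` —
  **finite energy at `p = 1/2`**: for an event `E` determined by a finite set of sites disjoint
  from `D`, `P_{1/2}(E ∩ paint D P) = P_{1/2}(E) · 2^{-|D|}` (the local involution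
  `ω ↦ ω ∆ (D ∖ P)`, `sitePercolation_half_real_preimage_of_involutive`, maps `E ∩ {D open}` onto
  `E ∩ paint D P`; independence `sitePercolation_real_inter_of_disjoint` and
  `sitePercolation_real_subset`); `real_plainArms_eq_mul_paint` — hence
  `P(plainArms κ s m n) = 2^{|D|} P(plainArms κ s m n ∩ paint D P)` for the core
  `D = Λ_m ∖ {s j}` and ANY paint `P`.

## References

* P. Nolin, Near-critical percolation in two dimensions, *Electron. J. Probab.* 13 (2008)
  1562–1623, §4.1 (arXiv 0711.4948, §4.1) [Nolin2008].
* B. Bollobás, O. Riordan, *Percolation*, CUP (2006), Ch. 7, p. 175 (measure-preserving local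
  bijections at `p = 1/2`) [BollobasRiordan2006].

## Mathlib / tree

Tree: `armEvent`, `IsColouredPath` (`ArmEvents.lean`); `mem_triAnnulus_of_arm`
(`ArmEventsProofs.lean`); `sitePercolation_half_real_preimage_of_involutive`
(`ColourSwitching.lean`); `sitePercolation_real_inter_of_disjoint`, `sitePercolation_real_subset`
(`SitePercolationMeasure.lean`); `PathIn.last_exit`, `PathIn.of_walk`, `PathIn.exists_walk`
(`SitePaths.lean`, `OneArmLSW.lean`); `card_triSphere_le` is NOT used (the bound is stated with
`#(∂Λ_m)^k`). Mathlib: `SimpleGraph.Walk.bypass`, `Fintype.piFinset`, `symmDiff`,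
`measureReal_biUnion_finset_le`.
-/

noncomputable section

open MeasureTheory Set
open scoped symmDiff

namespace Literature.Probability.Percolation

open LatticeModels

/-! ### Plain arms from a landing tuple -/

/-- **Plain arms from the landing tuple `s`.** `k` self-avoiding walks of `𝕋`, the `j`-th from
`s j` to a site of `∂Λ_n`, monochromatic of colour `κ j`, pairwise vertex-disjoint, every site of
which other than its start has norm in `(m, n]` (so that the arms meet `Λ_m` only in their
starts). [cite: Nolin2008, §4.1 (arXiv 0711.4948, §4.1)] -/
def plainArms {k : ℕ} (κ : Fin k → Bool) (s : Fin k → Site 2) (m n : ℕ) : Set (SiteConfig (Site 2)) :=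
  {ω | ∃ (y : Fin k → Site 2) (w : ∀ j, triGraph.Walk (s j) (y j)),
    (∀ j, y j ∈ triSphere n ∧ (w j).IsPath ∧
      (∀ v ∈ (w j).support, v = s j ∨ ((m : ℤ) < triNorm v ∧ triNorm v ≤ n)) ∧ IsColouredPath ω (κ j) (w j)) ∧
    Pairwise fun i j => Disjoint (w i).support.toFinset (w j).support.toFinset}

variable {k : ℕ}

/-- **Trimming one arm at its last site of norm `≤ m`.** [folklore] -/
theorem exists_trim_arm {m n : ℕ} (hmn : m ≤ n) {x y : Site 2} (w : triGraph.Walk x y) (hx : x ∈ triSphere m)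
    (hy : y ∈ triSphere n)
    (hw : ∀ v ∈ w.support, v ∈ (↑(triBall n) : Set (Site 2)) \ ↑(triBall m) ∨ v ∈ triSphere m) :
    ∃ a ∈ triSphere m, ∃ w' : triGraph.Walk a y, w'.IsPath ∧
      (∀ v ∈ w'.support, v = a ∨ ((m : ℤ) < triNorm v ∧ triNorm v ≤ n)) ∧ ∀ v ∈ w'.support, v ∈ w.support := by
  classical
  have hnorm : ∀ v ∈ w.support, triNorm v ≤ n ∧ ((m : ℤ) < triNorm v ∨ triNorm v = m) := by
    intro v hv
    rcases hw v hv with h | h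
    · simp only [Set.mem_sdiff, Finset.mem_coe, mem_triBall_iff, not_le] at h
      exact ⟨h.1, Or.inl h.2⟩
    · rw [mem_triSphere_iff] at h
      exact ⟨by have := hmn; omega, Or.inr h⟩
  by_cases hyC : triNorm y ≤ m
  · -- `m = n` and the arm is trimmed to its endpoint
    have hym : y ∈ triSphere m := by
      rw [mem_triSphere_iff] at hy ⊢; have := hmn; omega
    refine ⟨y, hym, SimpleGraph.Walk.nil, SimpleGraph.Walk.IsPath.nil, fun v hv => ?_, fun v hv => ?_⟩
    · rw [SimpleGraph.Walk.support_nil, List.mem_singleton] at hv; exact Or.inl hv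
    · rw [SimpleGraph.Walk.support_nil, List.mem_singleton] at hv; rw [hv]; exact w.end_mem_support
  · have hp : PathIn triGraph {v | v ∈ w.support} x y := PathIn.of_walk w fun v hv => hv
    obtain ⟨a, b, haC, haA, hbC, hab, hq⟩ := hp.last_exit (C := {v | triNorm v ≤ m}) (by
      change triNorm x ≤ m; rw [mem_triSphere_iff] at hx; omega) hyC
    change triNorm a ≤ m at haC
    change ¬ triNorm b ≤ m at hbC
    have ham : a ∈ triSphere m := by
      rw [mem_triSphere_iff]; rcases (hnorm a haA).2 with h | h <;> omega
    -- the trimmed arm: `a → b ⋯ → y` inside `{a} ∪ (support ∖ Λ_m)`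
    set T : Set (Site 2) := {v | v = a ∨ (v ∈ w.support ∧ ¬ triNorm v ≤ m)} with hT
    have hq' : PathIn triGraph T a y := by
      have hbT : b ∈ T := Or.inr ⟨hq.left_mem.1, hbC⟩
      refine (PathIn.of_adj (A := T) (Or.inl rfl) hbT hab).trans (hq.mono ?_)
      rintro v ⟨hv, hv'⟩; exact Or.inr ⟨hv, hv'⟩
    obtain ⟨W, hW⟩ := hq'.exists_walk
    refine ⟨a, ham, W.bypass, W.bypass_isPath, fun v hv => ?_, fun v hv => ?_⟩
    · rcases hW v (W.support_bypass_subset_support hv) with h | ⟨h, h'⟩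
      · exact Or.inl h
      · exact Or.inr ⟨by omega, (hnorm v h).1⟩
    · rcases hW v (W.support_bypass_subset_support hv) with h | ⟨h, -⟩
      · rw [h]; exact haA
      · exact h

/-- **Trimming** (Nolin §4.1: arms may be assumed to touch the inner boundary only at their
extremities). For `m ≤ n`, every configuration of `armEvent κ m n` lies in `plainArms κ s m n` for
some injective landing tuple `s` on `∂Λ_m`. [cite: Nolin2008, §4.1 (arXiv 0711.4948, §4.1)] -/
theorem exists_plainArms_of_mem_armEvent (κ : Fin k → Bool) {m n : ℕ} (hmn : m ≤ n) {ω : SiteConfig (Site 2)}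
    (hω : ω ∈ armEvent κ m n) :
    ∃ s : Fin k → Site 2, (∀ j, s j ∈ triSphere m) ∧ Function.Injective s ∧ ω ∈ plainArms κ s m n := by
  classical
  obtain ⟨x, y, w, hw, hd⟩ := hω
  have htrim : ∀ j, ∃ a ∈ triSphere m, ∃ w' : triGraph.Walk a (y j), w'.IsPath ∧
      (∀ v ∈ w'.support, v = a ∨ ((m : ℤ) < triNorm v ∧ triNorm v ≤ n)) ∧ ∀ v ∈ w'.support, v ∈ (w j).support :=
    fun j => exists_trim_arm hmn (w j) (hw j).1 (hw j).2.1 (hw j).2.2.2.1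
  choose s hs w' hw'p hw's hw'sub using htrim
  have hdisj : Pairwise fun i j => Disjoint (w' i).support.toFinset (w' j).support.toFinset := by
    intro i j hij
    exact Finset.disjoint_left.2 fun v hv hv' => Finset.disjoint_left.1 (hd hij)
      (List.mem_toFinset.2 (hw'sub i v (List.mem_toFinset.1 hv))) (List.mem_toFinset.2 (hw'sub j v (List.mem_toFinset.1 hv')))
  refine ⟨s, hs, fun i j h => ?_, y, w', fun j => ⟨(hw j).2.1, hw'p j, hw's j, fun v hv => (hw j).2.2.2.2 v (hw'sub j v hv)⟩, hdisj⟩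
  by_contra hij
  have h1 : s i ∈ (w' i).support.toFinset := List.mem_toFinset.2 (w' i).start_mem_support
  have h2 : s i ∈ (w' j).support.toFinset := by rw [h]; exact List.mem_toFinset.2 (w' j).start_mem_support
  exact Finset.disjoint_left.1 (hdisj hij) h1 h2

/-- The finite set of landing tuples on `∂Λ_m`. [folklore] -/
def landingTuples (k m : ℕ) : Finset (Fin k → Site 2) := Fintype.piFinset fun _ => triSphere m

/-- **The arm event is covered by the plain-arm events of the landing tuples.** [cite: Nolin2008, §4.1 (arXiv 0711.4948, §4.1)] -/
theorem armEvent_subset_biUnion_plainArms (κ : Fin k → Bool) {m n : ℕ} (hmn : m ≤ n) :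
    armEvent κ m n ⊆ ⋃ s ∈ landingTuples k m, plainArms κ s m n := by
  intro ω hω
  obtain ⟨s, hs, -, hmem⟩ := exists_plainArms_of_mem_armEvent κ hmn hω
  exact Set.mem_biUnion (Fintype.mem_piFinset.2 hs) hmem

/-- **Union bound**: `π_κ(m, n) ≤ Σ_s P_{1/2}(plainArms κ s m n)` over the landing tuples on `∂Λ_m`.
[cite: Nolin2008, §4.1 (arXiv 0711.4948, §4.1)] -/
theorem polyArmProb_le_sum_plainArms (κ : Fin k → Bool) {m n : ℕ} (hmn : m ≤ n) :
    polyArmProb κ m n ≤ ∑ s ∈ landingTuples k m, (triSitePercolation half).real (plainArms κ s m n) :=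
  (measureReal_mono (armEvent_subset_biUnion_plainArms κ hmn) (measure_ne_top _ _)).trans
    (measureReal_biUnion_finset_le _ _)

/-- The number of landing tuples is `#(∂Λ_m)^k`. [folklore] -/
theorem card_landingTuples (k m : ℕ) : (landingTuples k m).card = (triSphere m).card ^ k := by
  rw [landingTuples, Fintype.card_piFinset, Finset.prod_const, Finset.card_univ, Fintype.card_fin]

/-! ### Locality of the plain-arm event -/

/-- The sites the plain-arm event depends on: the landing sites and the annulus `Λ_n ∖ Λ_m`. [folklore] -/
def plainSites (s : Fin k → Site 2) (m n : ℕ) : Finset (Site 2) := Finset.univ.image s ∪ (triBall n \ triBall m)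

/-- The sites of the arms of `plainArms κ s m n` lie in `plainSites s m n`. [folklore] -/
theorem mem_plainSites_of_arm {s : Fin k → Site 2} {m n : ℕ} {j : Fin k} {v : Site 2}
    (hv : v = s j ∨ ((m : ℤ) < triNorm v ∧ triNorm v ≤ n)) : v ∈ plainSites s m n := by
  rcases hv with rfl | ⟨h1, h2⟩
  · exact Finset.mem_union_left _ (Finset.mem_image_of_mem _ (Finset.mem_univ _))
  · refine Finset.mem_union_right _ (Finset.mem_sdiff.2 ⟨mem_triBall_iff.2 h2, fun h => ?_⟩)
    rw [mem_triBall_iff] at h; omega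

/-- Configurations agreeing on `plainSites s m n` have plain arms together. [folklore] -/
theorem plainArms_congr {κ : Fin k → Bool} {s : Fin k → Site 2} {m n : ℕ} {ω ω' : SiteConfig (Site 2)}
    (h : ∀ v ∈ plainSites s m n, (v ∈ ω ↔ v ∈ ω')) (hω : ω ∈ plainArms κ s m n) : ω' ∈ plainArms κ s m n := by
  obtain ⟨y, w, hw, hd⟩ := hω
  refine ⟨y, w, fun j => ⟨(hw j).1, (hw j).2.1, (hw j).2.2.1, fun v hv => ?_⟩, hd⟩
  rw [← h v (mem_plainSites_of_arm ((hw j).2.2.1 v hv))]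
  exact (hw j).2.2.2 v hv

/-- **The plain-arm event is determined by the landing sites and the annulus.** [folklore] -/
theorem determinedBy_plainArms (κ : Fin k → Bool) (s : Fin k → Site 2) (m n : ℕ) :
    DeterminedBy (plainArms κ s m n) ↑(plainSites s m n) := by
  rw [determinedBy_iff]
  intro ω ω' hF
  have key : ∀ v ∈ plainSites s m n, (v ∈ ω ↔ v ∈ ω') := fun v hv => by
    have e := Set.ext_iff.1 hF v
    exact ⟨fun h => (e.1 ⟨h, Finset.mem_coe.2 hv⟩).1, fun h => (e.2 ⟨h, Finset.mem_coe.2 hv⟩).1⟩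
  exact ⟨plainArms_congr key, plainArms_congr fun v hv => (key v hv).symm⟩

/-- The plain-arm event is measurable. [folklore] -/
theorem measurableSet_plainArms (κ : Fin k → Bool) (s : Fin k → Site 2) (m n : ℕ) : MeasurableSet (plainArms κ s m n) :=
  (determinedBy_plainArms κ s m n).measurableSet_of_finset

/-! ### Painting a finite set of sites: finite energy at `p = 1/2` -/

/-- **The paint cylinder**: the sites of `D` are open exactly on `P`. [folklore] -/
def paint (D : Finset (Site 2)) (P : Set (Site 2)) : Set (SiteConfig (Site 2)) := {ω | ∀ v ∈ D, v ∈ ω ↔ v ∈ P}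

/-- The paint cylinder is determined by the painted sites. [folklore] -/
theorem determinedBy_paint (D : Finset (Site 2)) (P : Set (Site 2)) : DeterminedBy (paint D P) ↑D := by
  rw [determinedBy_iff]
  intro ω ω' hF
  have key : ∀ v ∈ D, (v ∈ ω ↔ v ∈ ω') := fun v hv => by
    have e := Set.ext_iff.1 hF v
    exact ⟨fun h => (e.1 ⟨h, Finset.mem_coe.2 hv⟩).1, fun h => (e.2 ⟨h, Finset.mem_coe.2 hv⟩).1⟩
  exact ⟨fun h v hv => (key v hv).symm.trans (h v hv), fun h v hv => (key v hv).trans (h v hv)⟩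

/-- **Finite energy at `p = 1/2`.** For an event `E` determined by a finite set of sites `F`
disjoint from `D`, `P_{1/2}(E ∩ paint D P) = P_{1/2}(E) · 2^{-|D|}`: the local involution
`ω ↦ ω ∆ (D ∖ P)` preserves `P_{1/2}` and maps `E ∩ {D open}` onto `E ∩ paint D P`, and
`P(E ∩ {D open}) = P(E) 2^{-|D|}` by independence. (Nolin: "we can prescribe their states at the
cost of a constant factor"; Bollobás–Riordan p. 175: measure-preserving local bijections.)
[cite: Nolin2008, §4.1 (arXiv 0711.4948, §4.1)] -/
theorem real_inter_paint {E : Set (SiteConfig (Site 2))} {F D : Finset (Site 2)} (hE : DeterminedBy E ↑F)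
    (hFD : Disjoint F D) (P : Set (Site 2)) :
    (triSitePercolation half).real (E ∩ paint D P) = (triSitePercolation half).real E * (1 / 2) ^ D.card := by
  classical
  -- the involution
  set T : Set (Site 2) := {v | v ∈ D ∧ v ∉ P} with hT
  set Φ : Set (Site 2) → Set (Site 2) := fun ω => ω ∆ T with hΦ
  have hinv : ∀ ω, Φ (Φ ω) = ω := fun ω => symmDiff_symmDiff_cancel_right _ _
  have hmemΦ : ∀ ω v, v ∈ Φ ω ↔ (v ∈ ω ∧ v ∉ T ∨ v ∈ T ∧ v ∉ ω) := fun ω v => Set.mem_symmDiff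
  have hmemT : ∀ ω v, v ∈ T → (v ∈ Φ ω ↔ v ∉ ω) := fun ω v hvT =>
    ⟨fun h => ((hmemΦ ω v).1 h).elim (fun h => absurd hvT h.2) fun h => h.2, fun h => (hmemΦ ω v).2 (Or.inr ⟨hvT, h⟩)⟩
  have hmemT' : ∀ ω v, v ∉ T → (v ∈ Φ ω ↔ v ∈ ω) := fun ω v hvT =>
    ⟨fun h => ((hmemΦ ω v).1 h).elim (fun h => h.1) fun h => absurd h.1 hvT, fun h => (hmemΦ ω v).2 (Or.inl ⟨h, hvT⟩)⟩
  have hloc : ∀ ω ω' : Set (Site 2), ω ∩ ↑(F ∪ D) = ω' ∩ ↑(F ∪ D) → Φ ω ∩ ↑(F ∪ D) = Φ ω' ∩ ↑(F ∪ D) := by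
    intro ω ω' h
    have key : ∀ v ∈ (↑(F ∪ D) : Set (Site 2)), (v ∈ ω ↔ v ∈ ω') := fun v hv =>
      ⟨fun h' => ((Set.ext_iff.1 h v).1 ⟨h', hv⟩).1, fun h' => ((Set.ext_iff.1 h v).2 ⟨h', hv⟩).1⟩
    ext v
    simp only [Set.mem_inter_iff]
    constructor <;> rintro ⟨h1, h2⟩ <;> refine ⟨?_, h2⟩
    · rw [hmemΦ] at h1 ⊢; rw [← key v h2]; exact h1
    · rw [hmemΦ] at h1 ⊢; rw [key v h2]; exact h1
  -- `Φ` fixes the states on `F`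
  have hΦF : ∀ ω, ∀ v ∈ F, (v ∈ Φ ω ↔ v ∈ ω) := fun ω v hv =>
    hmemT' ω v fun h => Finset.disjoint_left.1 hFD hv h.1
  have hΦE : ∀ ω, Φ ω ∈ E ↔ ω ∈ E := by
    intro ω
    rw [determinedBy_iff] at hE
    refine hE _ _ (Set.ext fun v => ?_)
    simp only [Set.mem_inter_iff, Finset.mem_coe]
    exact ⟨fun ⟨h1, h2⟩ => ⟨(hΦF ω v h2).1 h1, h2⟩, fun ⟨h1, h2⟩ => ⟨(hΦF ω v h2).2 h1, h2⟩⟩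
  -- `Φ⁻¹ (E ∩ {D open}) = E ∩ paint D P`
  have hpre : Φ ⁻¹' (E ∩ {ω | (↑D : Set (Site 2)) ⊆ ω}) = E ∩ paint D P := by
    ext ω
    simp only [Set.mem_preimage, Set.mem_inter_iff, hΦE, Set.mem_setOf_eq, paint, Set.subset_def, Finset.mem_coe]
    refine and_congr_right fun _ => forall₂_congr fun v hv => ?_
    by_cases hP : v ∈ P
    · rw [hmemT' ω v fun h => h.2 hP]; simp [hP]
    · rw [hmemT ω v ⟨hv, hP⟩]; simp [hP]
  -- the event `E ∩ {D open}` is determined by `F ∪ D`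
  have hED : DeterminedBy (E ∩ {ω | (↑D : Set (Site 2)) ⊆ ω}) ↑(F ∪ D) := by
    have h1 : DeterminedBy {ω : Set (Site 2) | (↑D : Set (Site 2)) ⊆ ω} ↑D := by
      rw [determinedBy_iff]
      intro ω ω' h
      simp only [Set.mem_setOf_eq]
      constructor <;> intro hs v hv
      · exact ((Set.ext_iff.1 h v).1 ⟨hs hv, hv⟩).1
      · exact ((Set.ext_iff.1 h v).2 ⟨hs hv, hv⟩).1
    rw [Finset.coe_union]
    exact (hE.mono Set.subset_union_left).inter (h1.mono Set.subset_union_right)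
  calc (triSitePercolation half).real (E ∩ paint D P)
      = (triSitePercolation half).real (Φ ⁻¹' (E ∩ {ω | (↑D : Set (Site 2)) ⊆ ω})) := by rw [hpre]
    _ = (triSitePercolation half).real (E ∩ {ω | (↑D : Set (Site 2)) ⊆ ω}) :=
        sitePercolation_half_real_preimage_of_involutive Φ hinv hloc hED
    _ = (triSitePercolation half).real E * (triSitePercolation half).real {ω | (↑D : Set (Site 2)) ⊆ ω} := by
        refine sitePercolation_real_inter_of_disjoint half hE ?_ hFD
        rw [determinedBy_iff]
        intro ω ω' h
        simp only [Set.mem_setOf_eq]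
        constructor <;> intro hs v hv
        · exact ((Set.ext_iff.1 h v).1 ⟨hs hv, hv⟩).1
        · exact ((Set.ext_iff.1 h v).2 ⟨hs hv, hv⟩).1
    _ = (triSitePercolation half).real E * (1 / 2) ^ D.card := by
        rw [show (triSitePercolation half).real {ω | (↑D : Set (Site 2)) ⊆ ω} = ((half : unitInterval) : ℝ) ^ D.card from
          sitePercolation_real_subset half D]
        simp [half]

/-- The core of the landing tuple `s`: the sites of `Λ_m` other than the landing sites. [folklore] -/
def coreOf (s : Fin k → Site 2) (m : ℕ) : Finset (Site 2) := triBall m \ Finset.univ.image s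

/-- The core has at most `#Λ_m` sites. [folklore] -/
theorem card_coreOf_le (s : Fin k → Site 2) (m : ℕ) : (coreOf s m).card ≤ (triBall m).card :=
  Finset.card_le_card Finset.sdiff_subset

/-- The core is disjoint from the sites the plain-arm event depends on. [folklore] -/
theorem disjoint_plainSites_coreOf (s : Fin k → Site 2) (m n : ℕ) : Disjoint (plainSites s m n) (coreOf s m) := by
  rw [Finset.disjoint_left]
  intro v hv hv'
  rw [coreOf, Finset.mem_sdiff] at hv'
  rcases Finset.mem_union.1 hv with h | h
  · exact hv'.2 h
  · exact (Finset.mem_sdiff.1 h).2 hv'.1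

/-- **Painting the core costs a constant**: for every paint `P`,
`P_{1/2}(plainArms κ s m n) = 2^{|Λ_m ∖ {s j}|} · P_{1/2}(plainArms κ s m n ∩ paint (Λ_m ∖ {s j}) P)`.
[cite: Nolin2008, §4.1 (arXiv 0711.4948, §4.1)] -/
theorem real_plainArms_eq_mul_paint (κ : Fin k → Bool) (s : Fin k → Site 2) (m n : ℕ) (P : Set (Site 2)) :
    (triSitePercolation half).real (plainArms κ s m n) =
      2 ^ (coreOf s m).card * (triSitePercolation half).real (plainArms κ s m n ∩ paint (coreOf s m) P) := by
  rw [real_inter_paint (determinedBy_plainArms κ s m n) (disjoint_plainSites_coreOf s m n) P, mul_comm,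
    mul_assoc, ← mul_pow]
  norm_num

end Literature.Probability.Percolation

end
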